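import Literature.LinearAlgebra.Matrix.CommutantEigencharacters                       -- ★ p851310 (F0P3-p04 (g17)): `exists_eigencharacters`
import Literature.LinearAlgebra.Matrix.NonderogatoryCommutant                         -- ★ `exists_eq_aeval_of_commute_of_minpoly_eq_charpoly`, `conj`∕Weyl template ideas (ED. 2)
import Literature.LinearAlgebra.Matrix.NonderogatoryCommutantBaseChange               -- ★ `minpoly_eq_charpoly_of_charpoly_separable` (ED. 2)
import Mathlib.LinearAlgebra.Vandermonde
import Mathlib.GroupTheory.Index
import HarnessLib

/-!
# F0 · P3c · line LH6 «StCharTS» — «TRACE-PAIRING★» (generic linear algebra feeding «ELL-CARTAN-COMPACT★»): for `A ∈ M_N(K)` with SEPARABLE characteristic polynomial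
# the trace pairing of `K[A]` is NON-DEGENERATE in the power basis `1, A, …, A^{N−1}` [HornJohnson2013, Thm. 3.2.4.2; Rogawski1990, §3.1 p. 19]

Cell `pub/hodgecm-mathlib`, crux H413 = `stmt-HodgeConjecture-24833` (lane `--supports … --as helper`), route HCCMUnconditional; seat F0P3a-p03 (g23); the generic half of the
census-first default «ELL-CARTAN-COMPACT★» (datum road of the (S-𝔇) organ, map owner LH6-p01 (g4); announced 2026-09-02T12:24Z).  THEOREMS ONLY (no definition ∕ instance ∕
notation ∕ named fact ∕ `sorry`); ★-only imports + Mathlib.  Kept in its own file (one topic; the consumer `F0P3cStCharTSEllCartanCompact` imports it).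

WHAT (any field `K`, any `N`).
* `eigencharacter_pow` — for a `K`-linear `χ : M_N(K) → L` with `χ 1 = 1`, multiplicative on the commutant of `A`: `χ(A^i) = χ(A)^i`.
* **`eq_zero_of_forall_trace_mul_pow_eq_zero`** — if `p_A` is separable and `c : Fin N → K` has `tr((Σ_i c_i A^i) · A^j) = 0` for all `j < N`, then `c = 0`.  Proof over an
  algebraic closure `K̄`: by ★ `exists_eigencharacters` there are `K`-linear `χ_k : M_N(K) → K̄`, multiplicative on the commutant of `A`, with `p_X = Π_k (X − χ_k(X))` for every
  `X` commuting with `A`, so `tr X = Σ_k χ_k(X)` there (Mathlib `Matrix.trace_eq_neg_charpoly_coeff`, `prod_X_sub_C_coeff_card_pred`); with `λ_k := χ_k(A)` (pairwise distinct)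
  and `q := Σ_i c_i X^i ∈ K̄[X]`, `χ_k((Σ c_i A^i)·A^j) = q(λ_k)·λ_k^j`, so the hypothesis says `(q(λ_k))_k ·ᵥ Vandermonde(λ) = 0`; the Vandermonde matrix is invertible
  (`Matrix.det_vandermonde_ne_zero_iff`), hence every `q(λ_k) = 0`, and `deg q < N` with `N` distinct roots forces `q = 0` (`eq_zero_of_natDegree_lt_card_of_eval_eq_zero`),
  i.e. `c = 0`.
* **`exists_linearEquiv_tracePairing`** — the pairing `c ↦ (tr((Σ_i c_i A^i) · A^j))_j` as a LINEAR AUTOMORPHISM of `K^N` (injective endomorphism of a finite-dimensional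
  space).  Use (★ `F0P3cStCharTSEllCartanCompact`): the coordinates of the centraliser of a regular element of `U(Φ₃)(L⁺_v)` in the power basis are controlled by traces.
ED. 2 (append-only, «WEYL-FIN★» generic half): `algebraMap_trace_eq_sum_eigencharacter` (`tr = Σ_k χ_k` on the commutant, for ANY eigencharacter family with the
★ product formula); `eq_zero_of_commute_of_forall_eigencharacter_eq_zero` (an element of the commutant killed by every eigencharacter is `0` — ★ nonderogatory commutant
+ the trace pairing); **`finite_setOf_commute_and_charpoly_eq`** — `{B | B A = A B ∧ p_B = p_A}` is FINITE (the eigencharacter vector is injective on the commutant and takes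
values in `(roots of p_A in K̄)^N` there); **`index_centralizer_subgroupOf_normalizer_ne_zero_of_injective`** — for ANY group `G` with an injective `ρ : G →* GL_N(K)` and
`g ∈ G` with `p_{ρ g}` separable, THE WEYL GROUP `N(Z(g)) ∕ Z(g)` IS FINITE (`n ↦ ρ(n g n⁻¹)` maps `N(Z(g))` into that finite set with fibres the cosets of `Z(g)`) — the
all-`N` form of ★ `RegularSemisimpleCentralizerGL.index_centralizer_subgroupOf_normalizer_ne_zero` (`N = 2`). [HarishChandra1970, Lemma 42: `W_A = Ã ∕ A` is finite.]
HONEST LABEL: HC_CM is proved only modulo the 7 printed citations (2 remaining named inputs: hLiu418 = `stmt-HodgeConjecture-24832`, h413 = `stmt-HodgeConjecture-24833`)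
until rung 0 closes; this file closes no organ (count-neutral, generic).

## References
* [HornJohnson2013] R. A. Horn, C. R. Johnson, *Matrix Analysis*, 2nd ed. (2013), Thm. 3.2.4.2 (the commutant of a nonderogatory matrix is `K[A]`); §0.9.11 (Vandermonde).
* [Rogawski1990] J. D. Rogawski, *Automorphic Representations of Unitary Groups in Three Variables*, Ann. of Math. Stud. 123 (1990), §3.1 p. 19 (regular semisimple elements);
  §3.5 p. 28 (`Ω_F(T, G)`).
* [HarishChandra1970] Harish-Chandra (notes by G. van Dijk), *Harmonic Analysis on Reductive p-adic Groups*, LNM 162 (1970), Lemma 42 (`W_A = Ã ∕ A` is finite).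
-/

set_option autoImplicit false
-- the mandated namespace has the single-problem summit's repeated segment (`HodgeConjecture.HodgeConjecture`)
set_option linter.dupNamespace false

noncomputable section

open Polynomial
open scoped Matrix

namespace Summit.HodgeConjecture.HodgeConjecture.Cruxes.H413.F0P3cStCharTSTracePairing

/-! ## The trace pairing of `K[A]` in the power basis -/

section TracePairing

variable {K : Type*} [Field K] {N : ℕ}

/-- For a `K`-linear `χ : M_N(K) → L` with `χ 1 = 1`, multiplicative on the commutant of `A`: `χ (A^i) = (χ A)^i`. [cite: HornJohnson2013, Thm. 3.2.4.2] -/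
theorem eigencharacter_pow {L' : Type*} [Field L'] [Algebra K L'] {A : Matrix (Fin N) (Fin N) K} (χ : Matrix (Fin N) (Fin N) K →ₗ[K] L') (h1 : χ 1 = 1)
    (hmul : ∀ a c : Matrix (Fin N) (Fin N) K, Commute a A → Commute c A → χ (a * c) = χ a * χ c) (i : ℕ) :
    χ (A ^ i) = χ A ^ i := by
  induction i with
  | zero => rw [pow_zero, pow_zero, h1]
  | succ i ih => rw [pow_succ, hmul _ _ ((Commute.refl A).pow_left i) (Commute.refl A), ih, pow_succ]

/-- **Non-degeneracy of the trace pairing on `K[A]` in the power basis.**  Let `A ∈ M_N(K)` have SEPARABLE characteristic polynomial.  If `c : Fin N → K` satisfies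
`tr((Σ_i c_i A^i) · A^j) = 0` for every `j < N`, then `c = 0`.  (Over an algebraic closure, `tr = Σ_k χ_k` on the commutant of `A` for the eigencharacters `χ_k` (★
`exists_eigencharacters`); `χ_k(Σ c_i A^i · A^j) = q(λ_k) λ_k^j` with `q = Σ c_i X^i`, `λ_k = χ_k(A)` pairwise distinct; the Vandermonde matrix at `λ` is invertible, so all
`q(λ_k) = 0`; `deg q < N` forces `q = 0`.) [cite: HornJohnson2013, Thm. 3.2.4.2] [cite: Rogawski1990, §3.1 p. 19] -/
theorem eq_zero_of_forall_trace_mul_pow_eq_zero (A : Matrix (Fin N) (Fin N) K) (hA : A.charpoly.Separable) (c : Fin N → K)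
    (h : ∀ j : Fin N, Matrix.trace ((∑ i : Fin N, c i • A ^ (i : ℕ)) * A ^ (j : ℕ)) = 0) : c = 0 := by
  classical
  rcases Nat.eq_zero_or_pos N with hN | hN
  · subst hN; exact funext fun i => Fin.elim0 i
  haveI : Nonempty (Fin N) := ⟨⟨0, hN⟩⟩
  set φ : K →+* AlgebraicClosure K := algebraMap K (AlgebraicClosure K) with hφ
  have hφi : Function.Injective φ := (algebraMap K (AlgebraicClosure K)).injective
  obtain ⟨χ, h1, hmul, hinj, hchar⟩ := Literature.LinearAlgebra.Matrix.exists_eigencharacters (L := AlgebraicClosure K) A hA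
  set M : Matrix (Fin N) (Fin N) K := ∑ i : Fin N, c i • A ^ (i : ℕ) with hM
  have hMc : Commute M A := Commute.sum_left _ _ _ fun i _ => ((Commute.refl A).pow_left (i : ℕ)).smul_left (c i)
  -- (I) `φ (tr X) = Σ_k χ_k X` for `X` commuting with `A`
  have htr : ∀ X : Matrix (Fin N) (Fin N) K, Commute X A → φ (Matrix.trace X) = ∑ k, χ k X := by
    intro X hX
    have hcoeff : ((X.map φ).charpoly).coeff (Fintype.card (Fin N) - 1) = -∑ k, χ k X := by
      rw [Matrix.charpoly_map, hchar X hX]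
      have h0 : 0 < (Finset.univ : Finset (Fin N)).card := Finset.card_pos.2 Finset.univ_nonempty
      rw [show Fintype.card (Fin N) = (Finset.univ : Finset (Fin N)).card from rfl, prod_X_sub_C_coeff_card_pred _ _ h0]
    rw [AddMonoidHom.map_trace φ X, Matrix.trace_eq_neg_charpoly_coeff, hcoeff, neg_neg]
  -- (II) `χ_k M = q(λ_k)` with `q = Σ φ(c_i) X^i`
  set lam : Fin N → AlgebraicClosure K := fun k => χ k A with hlam
  set q : (AlgebraicClosure K)[X] := ∑ i : Fin N, C (φ (c i)) * X ^ (i : ℕ) with hq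
  have hχM : ∀ k, χ k M = q.eval (lam k) := by
    intro k
    rw [hM, map_sum, hq, eval_finsetSum]
    refine Finset.sum_congr rfl fun i _ => ?_
    rw [LinearMap.map_smul, eigencharacter_pow (χ k) (h1 k) (hmul k) i, eval_mul, eval_C, eval_pow, eval_X, Algebra.smul_def]
  -- (III) the Vandermonde system `Σ_k χ_k(M) λ_k^j = 0`
  have hsys : (fun k => χ k M) ᵥ* Matrix.vandermonde lam = 0 := by
    funext j
    rw [Matrix.vecMul, dotProduct, Pi.zero_apply]
    have hj := congrArg φ (h j)
    rw [map_zero, htr _ (hMc.mul_left ((Commute.refl A).pow_left (j : ℕ)))] at hj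
    rw [← hj]
    refine Finset.sum_congr rfl fun k _ => ?_
    rw [Matrix.vandermonde_apply, hmul k M (A ^ (j : ℕ)) hMc ((Commute.refl A).pow_left (j : ℕ)), eigencharacter_pow (χ k) (h1 k) (hmul k) (j : ℕ)]
  have hV : IsUnit (Matrix.vandermonde lam) := by
    rw [Matrix.isUnit_iff_isUnit_det, isUnit_iff_ne_zero]
    exact Matrix.det_vandermonde_ne_zero_iff.2 hinj
  have hu : (fun k => χ k M) = 0 := by
    have hinjV := Matrix.vecMul_injective_iff_isUnit.2 hV
    exact hinjV (hsys.trans (Matrix.zero_vecMul _).symm)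
  -- (IV) `q` has the `N` distinct roots `λ_k` and degree `< N`, so `q = 0`
  have hq0 : q = 0 := by
    refine eq_zero_of_natDegree_lt_card_of_eval_eq_zero q hinj (fun k => ?_) ?_
    · rw [← hχM k]; exact congr_fun hu k
    · have hle : q.natDegree ≤ N - 1 := by
        rw [hq]
        refine natDegree_sum_le_of_forall_le _ _ fun i _ => (natDegree_C_mul_X_pow_le _ _).trans ?_
        have := i.2; omega
      rw [Fintype.card_fin]; omega
  -- (V) read off the coefficients
  funext i
  have hci : q.coeff (i : ℕ) = φ (c i) := by
    rw [hq, finsetSum_coeff, Finset.sum_eq_single i]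
    · rw [coeff_C_mul_X_pow, if_pos rfl]
    · intro b _ hb
      rw [coeff_C_mul_X_pow, if_neg (fun h => hb (Fin.ext h.symm))]
    · intro hi; exact absurd (Finset.mem_univ i) hi
  rw [hq0, coeff_zero] at hci
  exact (map_eq_zero_iff φ hφi).1 hci.symm

/-- **The trace pairing as an INVERTIBLE linear endomorphism of `K^N`**: `c ↦ (tr((Σ_i c_i A^i) · A^j))_j` is a linear equivalence when `p_A` is separable (injective by
`eq_zero_of_forall_trace_mul_pow_eq_zero`, hence bijective). [cite: HornJohnson2013, Thm. 3.2.4.2] -/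
theorem exists_linearEquiv_tracePairing (A : Matrix (Fin N) (Fin N) K) (hA : A.charpoly.Separable) :
    ∃ e : (Fin N → K) ≃ₗ[K] (Fin N → K), ∀ c : Fin N → K, ∀ j : Fin N,
      e c j = Matrix.trace ((∑ i : Fin N, c i • A ^ (i : ℕ)) * A ^ (j : ℕ)) := by
  classical
  let f : (Fin N → K) →ₗ[K] (Fin N → K) :=
    { toFun := fun c j => Matrix.trace ((∑ i : Fin N, c i • A ^ (i : ℕ)) * A ^ (j : ℕ))
      map_add' := fun c c' => by
        funext j
        simp only [Pi.add_apply, add_smul, Finset.sum_add_distrib, add_mul, Matrix.trace_add]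
      map_smul' := fun r c => by
        funext j
        simp only [Pi.smul_apply, smul_eq_mul, RingHom.id_apply, mul_smul, ← Finset.smul_sum, Matrix.smul_mul, Matrix.trace_smul] }
  have hinj : Function.Injective f := by
    rw [← LinearMap.ker_eq_bot, LinearMap.ker_eq_bot']
    intro c hc
    exact eq_zero_of_forall_trace_mul_pow_eq_zero A hA c fun j => congr_fun hc j
  exact ⟨LinearEquiv.ofBijective f ⟨hinj, LinearMap.injective_iff_surjective.1 hinj⟩, fun c j => rfl⟩

/-! ## ED. 2 — «WEYL-FIN★» generic half: finitely many commutant elements with a given characteristic polynomial; the Weyl group of a regular element is finite -/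

/-- **`tr = Σ_k χ_k` on the commutant**: for any family of `K`-linear `χ_k : M_N(K) → L'` with the product formula `p_a = Π_k (X − χ_k a)` over `L'` on the commutant of `A`
(★ `exists_eigencharacters`), `algebraMap (tr X) = Σ_k χ_k X` for every `X` commuting with `A`. [cite: HornJohnson2013, Thm. 3.2.4.2] -/
theorem algebraMap_trace_eq_sum_eigencharacter {L' : Type*} [Field L'] [Algebra K L'] {A : Matrix (Fin N) (Fin N) K}
    (χ : Fin N → (Matrix (Fin N) (Fin N) K →ₗ[K] L'))
    (hchar : ∀ a : Matrix (Fin N) (Fin N) K, Commute a A → (a.charpoly).map (algebraMap K L') = ∏ i, (X - C (χ i a)))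
    (X0 : Matrix (Fin N) (Fin N) K) (hX : Commute X0 A) :
    algebraMap K L' (Matrix.trace X0) = ∑ k, χ k X0 := by
  classical
  rcases Nat.eq_zero_or_pos N with hN | hN
  · subst hN
    rw [Matrix.trace, Fintype.sum_empty, Fintype.sum_empty, map_zero]
  haveI : Nonempty (Fin N) := ⟨⟨0, hN⟩⟩
  have hcoeff : ((X0.map (algebraMap K L')).charpoly).coeff (Fintype.card (Fin N) - 1) = -∑ k, χ k X0 := by
    rw [Matrix.charpoly_map, hchar X0 hX]
    have h0 : 0 < (Finset.univ : Finset (Fin N)).card := Finset.card_pos.2 Finset.univ_nonempty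
    rw [show Fintype.card (Fin N) = (Finset.univ : Finset (Fin N)).card from rfl, prod_X_sub_C_coeff_card_pred _ _ h0]
  rw [AddMonoidHom.map_trace (algebraMap K L') X0, Matrix.trace_eq_neg_charpoly_coeff, hcoeff, neg_neg]

/-- **An element of the commutant of `A` (separable `p_A`) killed by EVERY eigencharacter is `0`**: it is `Σ_{i<N} c_i A^i` (★ `exists_eq_aeval_of_commute_of_minpoly_eq_charpoly`,
`q_A = p_A` ★), all `tr(B·A^j) = Σ_k χ_k(B) χ_k(A)^j` vanish, and the trace pairing is non-degenerate. [cite: HornJohnson2013, Thm. 3.2.4.2] -/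
theorem eq_zero_of_commute_of_forall_eigencharacter_eq_zero {L' : Type*} [Field L'] [Algebra K L'] {A : Matrix (Fin N) (Fin N) K} (hA : A.charpoly.Separable)
    (χ : Fin N → (Matrix (Fin N) (Fin N) K →ₗ[K] L')) (h1 : ∀ i, χ i 1 = 1)
    (hmul : ∀ i (a c : Matrix (Fin N) (Fin N) K), Commute a A → Commute c A → χ i (a * c) = χ i a * χ i c)
    (hchar : ∀ a : Matrix (Fin N) (Fin N) K, Commute a A → (a.charpoly).map (algebraMap K L') = ∏ i, (X - C (χ i a)))
    {B : Matrix (Fin N) (Fin N) K} (hB : Commute B A) (hχ : ∀ k, χ k B = 0) : B = 0 := by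
  classical
  rcases Nat.eq_zero_or_pos N with hN | hN
  · subst hN; exact Subsingleton.elim _ _
  have hmin := Literature.LinearAlgebra.Matrix.minpoly_eq_charpoly_of_charpoly_separable A hA
  obtain ⟨p, hpdeg, hp⟩ := Literature.LinearAlgebra.Matrix.exists_eq_aeval_of_commute_of_minpoly_eq_charpoly A B hmin hB.symm
  have hpn : p.natDegree < N := by
    by_cases hp0 : p = 0
    · rw [hp0, natDegree_zero]; exact hN
    · have h' : p.degree < ((N : ℕ) : WithBot ℕ) := by simpa [Fintype.card_fin] using hpdeg
      exact (natDegree_lt_iff_degree_lt hp0).2 h'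
  set c : Fin N → K := fun i => p.coeff i with hc
  have hBc : B = ∑ i : Fin N, c i • A ^ (i : ℕ) := by
    rw [hp, aeval_eq_sum_range' hpn, Finset.sum_range (fun i => p.coeff i • A ^ i)]
  have hinjφ : Function.Injective (algebraMap K L') := (algebraMap K L').injective
  have hc0 : c = 0 := by
    refine eq_zero_of_forall_trace_mul_pow_eq_zero A hA c fun j => ?_
    rw [← hBc]
    apply hinjφ
    rw [map_zero, algebraMap_trace_eq_sum_eigencharacter χ hchar _ (hB.mul_left ((Commute.refl A).pow_left (j : ℕ)))]
    refine Finset.sum_eq_zero fun k _ => ?_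
    rw [hmul k B (A ^ (j : ℕ)) hB ((Commute.refl A).pow_left (j : ℕ)), hχ k, zero_mul]
  rw [hBc, hc0]
  simp

/-- **Finitely many elements of the commutant of `A` have a given characteristic polynomial** (`p_A` separable): the eigencharacter vector `B ↦ (χ_k B)_k ∈ K̄^N` is
INJECTIVE on the commutant (previous lemma) and, when `p_B = p_A`, takes values in the finite set `(roots of p_A)^N`. In particular `{B | BA = AB, p_B = p_A}` — the
conjugates of `A` inside its own centraliser torus — is finite. [cite: HarishChandra1970, Lemma 42] [cite: HornJohnson2013, Thm. 3.2.4.2] -/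
theorem finite_setOf_commute_and_charpoly_eq (A : Matrix (Fin N) (Fin N) K) (hA : A.charpoly.Separable) :
    Set.Finite {B : Matrix (Fin N) (Fin N) K | Commute B A ∧ B.charpoly = A.charpoly} := by
  classical
  set φ : K →+* AlgebraicClosure K := algebraMap K (AlgebraicClosure K) with hφ
  obtain ⟨χ, h1, hmul, -, hchar⟩ := Literature.LinearAlgebra.Matrix.exists_eigencharacters (L := AlgebraicClosure K) A hA
  let Ψ : Matrix (Fin N) (Fin N) K → (Fin N → AlgebraicClosure K) := fun B k => χ k B
  have hinjOn : Set.InjOn Ψ {B : Matrix (Fin N) (Fin N) K | Commute B A ∧ B.charpoly = A.charpoly} := by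
    intro B hB B' hB' hΨ
    have hsub : Commute (B - B') A := hB.1.sub_left hB'.1
    have h0 : ∀ k, χ k (B - B') = 0 := fun k => by
      rw [map_sub, sub_eq_zero]
      exact congr_fun hΨ k
    exact sub_eq_zero.1 (eq_zero_of_commute_of_forall_eigencharacter_eq_zero hA χ h1 hmul hchar hsub h0)
  have hne : (A.charpoly.map φ) ≠ 0 := ((Matrix.charpoly_monic A).map φ).ne_zero
  have himg : Ψ '' {B : Matrix (Fin N) (Fin N) K | Commute B A ∧ B.charpoly = A.charpoly} ⊆
      Set.pi Set.univ (fun _ : Fin N => (((A.charpoly.map φ).roots.toFinset : Finset (AlgebraicClosure K)) : Set (AlgebraicClosure K))) := by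
    rintro _ ⟨B, ⟨hBc, hBp⟩, rfl⟩ k -
    rw [Finset.mem_coe, Multiset.mem_toFinset, mem_roots hne, ← hBp, hchar B hBc, IsRoot.def, eval_prod]
    exact Finset.prod_eq_zero (Finset.mem_univ k) (by rw [eval_sub, eval_X, eval_C, sub_self])
  exact Set.Finite.of_finite_image ((Set.Finite.pi fun _ => Finset.finite_toSet _).subset himg) hinjOn

/-- **THE WEYL GROUP OF A REGULAR SEMISIMPLE ELEMENT IS FINITE.**  Let `ρ : G →* GL_N(K)` be injective and `g ∈ G` with `p_{ρ g}` separable.  Then the centraliser `Z(g)` has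
non-zero (i.e. finite) index in its normaliser `N(Z(g))`: `n ↦ ρ(n g n⁻¹)` maps `N(Z(g))` into the finite set `{B | B commutes with ρ g, p_B = p_{ρ g}}` with fibres exactly the
left cosets of `Z(g)`.  (All `N`; ★ `RegularSemisimpleCentralizerGL.index_centralizer_subgroupOf_normalizer_ne_zero` is the case `N = 2`, `G = GL₂`.)
[cite: HarishChandra1970, Lemma 42] [cite: Rogawski1990, §3.5 p. 28] -/
theorem index_centralizer_subgroupOf_normalizer_ne_zero_of_injective {G : Type*} [Group G] (ρ : G →* GL (Fin N) K) (hρ : Function.Injective ρ)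
    (g : G) (hg : ((ρ g : GL (Fin N) K) : Matrix (Fin N) (Fin N) K).charpoly.Separable) :
    ((Subgroup.centralizer ({g} : Set G)).subgroupOf
      (Subgroup.normalizer ((Subgroup.centralizer ({g} : Set G) : Subgroup G) : Set G))).index ≠ 0 := by
  classical
  set T : Subgroup G := Subgroup.centralizer ({g} : Set G) with hT
  set Nm : Subgroup G := Subgroup.normalizer (T : Set G) with hNm
  let F : Nm → Matrix (Fin N) (Fin N) K := fun n => ((ρ ((n : G) * g * (n : G)⁻¹) : GL (Fin N) K) : Matrix (Fin N) (Fin N) K)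
  -- the range of `F` lies in the finite set of commutant elements with the characteristic polynomial of `ρ g`
  have hrange : Set.range F ⊆ {B : Matrix (Fin N) (Fin N) K | Commute B ((ρ g : GL (Fin N) K) : Matrix (Fin N) (Fin N) K) ∧
      B.charpoly = ((ρ g : GL (Fin N) K) : Matrix (Fin N) (Fin N) K).charpoly} := by
    rintro _ ⟨n, rfl⟩
    have hmem : (n : G) * g * (n : G)⁻¹ ∈ T := (Subgroup.mem_normalizer_iff.1 n.2 g).1 (Subgroup.mem_centralizer_singleton_iff.2 rfl)
    rw [hT, Subgroup.mem_centralizer_singleton_iff] at hmem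
    have hcomm : Commute ((n : G) * g * (n : G)⁻¹) g := hmem
    refine ⟨(hcomm.map ρ).map (Units.coeHom (Matrix (Fin N) (Fin N) K)), ?_⟩
    show ((ρ ((n : G) * g * (n : G)⁻¹) : GL (Fin N) K) : Matrix (Fin N) (Fin N) K).charpoly = _
    rw [map_mul, map_mul, map_inv, Units.val_mul, Units.val_mul, Matrix.coe_units_inv, Matrix.charpoly_units_conj]
  have hfin : (Set.range F).Finite := (finite_setOf_commute_and_charpoly_eq _ hg).subset hrange
  -- the kernel of `F` is the coset relation of `T ∩ N` in `N`
  have hker : Setoid.ker F = QuotientGroup.leftRel (T.subgroupOf Nm) := by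
    ext n n'
    rw [Setoid.ker_def, QuotientGroup.leftRel_apply, Subgroup.mem_subgroupOf, hT, Subgroup.mem_centralizer_singleton_iff]
    constructor
    · intro h
      have h' : ρ ((n : G) * g * (n : G)⁻¹) = ρ ((n' : G) * g * (n' : G)⁻¹) := Units.ext h
      have h'' : (n : G) * g * (n : G)⁻¹ = (n' : G) * g * (n' : G)⁻¹ := hρ h'
      change ((n⁻¹ * n' : Nm) : G) * g = g * ((n⁻¹ * n' : Nm) : G)
      rw [Subgroup.coe_mul, Subgroup.coe_inv]
      calc ((n : G))⁻¹ * (n' : G) * g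
          = (n : G)⁻¹ * ((n' : G) * g * (n' : G)⁻¹) * (n' : G) := by group
        _ = (n : G)⁻¹ * ((n : G) * g * (n : G)⁻¹) * (n' : G) := by rw [← h'']
        _ = g * ((↑n)⁻¹ * ↑n') := by group
    · intro h
      change ((n⁻¹ * n' : Nm) : G) * g = g * ((n⁻¹ * n' : Nm) : G) at h
      rw [Subgroup.coe_mul, Subgroup.coe_inv] at h
      show ((ρ ((n : G) * g * (n : G)⁻¹) : GL (Fin N) K) : Matrix (Fin N) (Fin N) K) = ((ρ ((n' : G) * g * (n' : G)⁻¹) : GL (Fin N) K) : Matrix (Fin N) (Fin N) K)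
      congr 2
      symm
      calc (n' : G) * g * (n' : G)⁻¹
          = (n : G) * ((↑n)⁻¹ * ↑n' * g) * (n' : G)⁻¹ := by group
        _ = (n : G) * (g * ((↑n)⁻¹ * ↑n')) * (n' : G)⁻¹ := by rw [h]
        _ = (n : G) * g * (n : G)⁻¹ := by group
  haveI : Finite (Quotient (Setoid.ker F)) := by
    haveI : Finite ↥(Set.range F) := hfin.to_subtype
    exact Finite.of_equiv _ (Setoid.quotientKerEquivRange F).symm
  haveI : Finite (Nm ⧸ T.subgroupOf Nm) := by
    change Finite (Quotient (QuotientGroup.leftRel (T.subgroupOf Nm)))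
    rw [← hker]; infer_instance
  exact Subgroup.index_ne_zero_of_finite

end TracePairing

end Summit.HodgeConjecture.HodgeConjecture.Cruxes.H413.F0P3cStCharTSTracePairing

end
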